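import Mathlib.GroupTheory.PresentedGroup
import Mathlib.GroupTheory.OrderOfElement
import Mathlib.GroupTheory.Index
import Mathlib.FieldTheory.Finite.Basic
import Literature.GroupTheory.CombinatorialGroupTheory.HigmanGroupWitness
import HarnessLib

/-!
# Higman's group: finitely presented, infinite, with no non-trivial finite quotient

Topic `Literature/GroupTheory/CombinatorialGroupTheory`.

* `higmanGroup` — Higman's group `⟨a₀,a₁,a₂,a₃ ∣ aᵢ₊₁⁻¹ aᵢ aᵢ₊₁ = aᵢ² (i mod 4)⟩` as a `PresentedGroup`
  (Higman 1951).
* `HigmanGroup.hom_finite_eq_one` — every homomorphism from `higmanGroup` to a finite group is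
  trivial (Higman 1951, §1, the order argument: `b⁻¹ab = a²` forces `ord a ∣ 2^{ord b} - 1`, whence
  the least prime factor of `ord b` is smaller than that of `ord a`; around the 4-cycle this is
  absurd); hence no proper finite-index subgroup (`eq_top_of_finiteIndex`) and, for any surjection
  `π : F ↠ higmanGroup`, every finite-index subgroup of `F` maps ONTO it (`map_eq_top_of_finiteIndex`).
* `HigmanGroup.a_zero_ne_one`, `HigmanGroup.nontrivial`, `HigmanGroup.infinite` — the group is
  non-trivial (via the witness group of `HigmanGroupWitness.lean`, Higman 1951 §2) and therefore
  infinite; `normalClosure_rels_ne_top` — its relation subgroup is a proper normal subgroup of `F₄`.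

Not here: simplicity-type statements (Higman's group is SQ-universal, Schupp 1971) and the full
amalgam decomposition; only the witness needed for non-triviality is built.

Sources: G. Higman, *A finitely generated infinite simple group*, J. London Math. Soc. 26 (1951)
61–64; Lyndon–Schupp, *Combinatorial Group Theory*, IV.7.
-/

noncomputable section

namespace Literature.GroupTheory.CombinatorialGroupTheory

namespace HigmanGroup

/-! ## The relators and the presented group -/

/-- The relator `aⱼ⁻¹ aᵢ aⱼ aᵢ⁻²` (i.e. `aⱼ⁻¹ aᵢ aⱼ = aᵢ²`) in the free group on `Fin 4`.
[cite: Higman1951, §1] -/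
def rel (i j : Fin 4) : FreeGroup (Fin 4) :=
  (FreeGroup.of j)⁻¹ * FreeGroup.of i * FreeGroup.of j * (FreeGroup.of i)⁻¹ * (FreeGroup.of i)⁻¹

/-- Higman's four relators `a₁⁻¹a₀a₁a₀⁻²`, `a₂⁻¹a₁a₂a₁⁻²`, `a₃⁻¹a₂a₃a₂⁻²`, `a₀⁻¹a₃a₀a₃⁻²`.
[cite: Higman1951, §1] -/
def rels : Set (FreeGroup (Fin 4)) :=
  {rel 0 1, rel 1 2, rel 2 3, rel 3 0}

end HigmanGroup

/-- **Higman's group** `⟨a₀, a₁, a₂, a₃ ∣ a₁⁻¹a₀a₁ = a₀², a₂⁻¹a₁a₂ = a₁², a₃⁻¹a₂a₃ = a₂², a₀⁻¹a₃a₀ = a₃²⟩`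
(Higman 1951): the first example of a finitely presented infinite group without non-trivial finite
quotients. [cite: Higman1951, §1] -/
abbrev higmanGroup : Type := PresentedGroup HigmanGroup.rels

namespace HigmanGroup

/-- The generator `aᵢ` of Higman's group. [cite: Higman1951, §1] -/
def a (i : Fin 4) : higmanGroup := PresentedGroup.of i

/-- The defining relation `aⱼ⁻¹ aᵢ aⱼ = aᵢ²` holds in Higman's group for the four pairs
`(i, j) = (0,1), (1,2), (2,3), (3,0)`. [cite: Higman1951, §1] -/
theorem conj_eq_sq {i j : Fin 4} (h : rel i j ∈ rels) : (a j)⁻¹ * a i * a j = a i ^ 2 := by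
  have h1 : (PresentedGroup.mk rels (rel i j) : higmanGroup) = 1 :=
    (QuotientGroup.eq_one_iff _).2 (Subgroup.subset_normalClosure h)
  have h2 : (PresentedGroup.mk rels (rel i j) : higmanGroup) =
      (a j)⁻¹ * a i * a j * (a i)⁻¹ * (a i)⁻¹ := by
    simp [rel, a, PresentedGroup.of]
  rw [h2] at h1
  calc (a j)⁻¹ * a i * a j = ((a j)⁻¹ * a i * a j * (a i)⁻¹ * (a i)⁻¹) * (a i * a i) := by group
    _ = a i ^ 2 := by rw [h1, one_mul, sq]

/-! ## No non-trivial finite quotient (the order argument) -/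

section order

variable {Q : Type*} [Group Q]

/-- `b⁻¹ aᵐ b = (a²)ᵐ` from `b⁻¹ a b = a²`. [folklore] -/
theorem conj_pow_eq {a b : Q} (h : b⁻¹ * a * b = a ^ 2) (m : ℕ) :
    b⁻¹ * a ^ m * b = (a ^ 2) ^ m := by
  rw [← h]
  induction m with
  | zero => simp
  | succ m ihm => rw [pow_succ, pow_succ, ← ihm]; group

/-- `b⁻¹ a b = a²` implies `b⁻ⁿ a bⁿ = a^{2^n}`. [folklore] -/
theorem conj_pow_eq_pow_two_pow {a b : Q} (h : b⁻¹ * a * b = a ^ 2) (n : ℕ) :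
    (b ^ n)⁻¹ * a * b ^ n = a ^ 2 ^ n := by
  induction n with
  | zero => simp
  | succ n ih =>
    have : (b ^ (n + 1))⁻¹ * a * b ^ (n + 1) = b⁻¹ * ((b ^ n)⁻¹ * a * b ^ n) * b := by
      rw [pow_succ]; group
    rw [this, ih, conj_pow_eq h, ← pow_mul, pow_succ, mul_comm]

/-- If `b⁻¹ a b = a²` then `ord a ∣ 2^{ord b} - 1` (for `b` of infinite order both sides read `ord a ∣ 0`).
[cite: Higman1951, §1] -/
theorem orderOf_dvd_two_pow_sub_one {a b : Q} (h : b⁻¹ * a * b = a ^ 2) :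
    orderOf a ∣ 2 ^ orderOf b - 1 := by
  have h1 := conj_pow_eq_pow_two_pow h (orderOf b)
  rw [pow_orderOf_eq_one, inv_one, one_mul, mul_one] at h1
  apply orderOf_dvd_of_pow_eq_one
  have : a ^ (2 ^ orderOf b) = a ^ (2 ^ orderOf b - 1) * a := by
    rw [← pow_succ, Nat.sub_add_cancel Nat.one_le_two_pow]
  rw [← h1] at this
  exact mul_eq_right.mp this.symm

/-- `2ⁿ - 1` is odd for `n ≥ 1`. [folklore] -/
theorem not_two_dvd_two_pow_sub_one {n : ℕ} (hn : 0 < n) : ¬ 2 ∣ 2 ^ n - 1 := by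
  intro h2
  have h1 : 2 ∣ 2 ^ n := dvd_pow_self 2 (Nat.pos_iff_ne_zero.mp hn)
  have h3 : 2 ∣ 2 ^ n - (2 ^ n - 1) := Nat.dvd_sub h1 h2
  have h4 : 2 ^ n - (2 ^ n - 1) = 1 := by
    have := @Nat.one_le_two_pow n
    omega
  rw [h4] at h3
  exact absurd (Nat.le_of_dvd Nat.one_pos h3) (by decide)

/-- The least-prime-factor descent: if `b⁻¹ab = a²` with `a` of finite order `> 1` and `b` of finite
order, then `b ≠ 1` and the least prime factor of `ord b` is smaller than that of `ord a`.
[cite: Higman1951, §1] -/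
theorem minFac_orderOf_lt {a b : Q} (h : b⁻¹ * a * b = a ^ 2) (ha : IsOfFinOrder a) (ha1 : a ≠ 1)
    (hb : IsOfFinOrder b) :
    b ≠ 1 ∧ (orderOf b).minFac < (orderOf a).minFac := by
  set p := (orderOf a).minFac with hp
  have hoa : 1 < orderOf a := by
    rcases Nat.lt_or_ge 1 (orderOf a) with h' | h'
    · exact h'
    · exact absurd (orderOf_eq_one_iff.mp (le_antisymm h' ha.orderOf_pos)) ha1
  haveI hpp : Fact p.Prime := ⟨Nat.minFac_prime (ne_of_gt hoa)⟩
  have hpd : p ∣ orderOf a := Nat.minFac_dvd _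
  have hdvd := orderOf_dvd_two_pow_sub_one h
  have hob : 0 < orderOf b := hb.orderOf_pos
  -- `2 ^ ord b ≡ 1 (mod p)`
  have h2pow : (2 : ZMod p) ^ orderOf b = 1 := by
    have hd : p ∣ 2 ^ orderOf b - 1 := dvd_trans hpd hdvd
    have h0 : ((2 ^ orderOf b - 1 : ℕ) : ZMod p) = 0 := (ZMod.natCast_eq_zero_iff _ _).2 hd
    have h' : (2 ^ orderOf b : ℕ) = (2 ^ orderOf b - 1) + 1 :=
      (Nat.sub_add_cancel Nat.one_le_two_pow).symm
    have := congrArg (Nat.cast : ℕ → ZMod p) h'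
    push_cast at this
    rw [h0, zero_add] at this
    exact this
  -- `p` is odd
  have hp2 : p ≠ 2 := by
    intro hp2
    have h2d : 2 ∣ 2 ^ orderOf b - 1 := by
      have := dvd_trans hpd hdvd; rwa [hp2] at this
    exact not_two_dvd_two_pow_sub_one hob h2d
  have hp3 : 2 < p := lt_of_le_of_ne hpp.out.two_le (Ne.symm hp2)
  have htwo_ne_one : (2 : ZMod p) ≠ 1 := by
    intro h21
    have : ((2 : ℕ) : ZMod p) = ((1 : ℕ) : ZMod p) := by simpa using h21
    rw [ZMod.natCast_eq_natCast_iff'] at this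
    rw [Nat.mod_eq_of_lt hp3, Nat.mod_eq_of_lt (by omega)] at this
    exact absurd this (by decide)
  have h20 : (2 : ZMod p) ≠ 0 := by
    intro h20
    have : ((2 : ℕ) : ZMod p) = 0 := by simpa using h20
    rw [ZMod.natCast_eq_zero_iff] at this
    have := Nat.le_of_dvd (by norm_num) this
    omega
  -- the multiplicative order `o` of `2` modulo `p`: `1 < o`, `o ∣ ord b`, `o ∣ p - 1`
  have ho_dvd_b : orderOf (2 : ZMod p) ∣ orderOf b := orderOf_dvd_of_pow_eq_one h2pow
  have ho_dvd_p : orderOf (2 : ZMod p) ∣ p - 1 :=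
    orderOf_dvd_of_pow_eq_one (ZMod.pow_card_sub_one_eq_one h20)
  have ho_ne_one : orderOf (2 : ZMod p) ≠ 1 := fun ho1 =>
    htwo_ne_one (orderOf_eq_one_iff.mp ho1)
  have ho_pos : 0 < orderOf (2 : ZMod p) := by
    rw [orderOf_pos_iff]
    exact isOfFinOrder_iff_pow_eq_one.mpr ⟨orderOf b, hob, h2pow⟩
  have ho_gt : 1 < orderOf (2 : ZMod p) := lt_of_le_of_ne ho_pos (Ne.symm ho_ne_one)
  have hob1 : 1 < orderOf b :=
    lt_of_lt_of_le ho_gt (Nat.le_of_dvd hob ho_dvd_b)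
  refine ⟨fun hb1 => ?_, ?_⟩
  · rw [hb1, orderOf_one] at hob1; exact absurd hob1 (by decide)
  · calc (orderOf b).minFac ≤ (orderOf (2 : ZMod p)).minFac :=
          Nat.minFac_le_of_dvd (Nat.minFac_prime (ne_of_gt ho_gt)).two_le
            (dvd_trans (Nat.minFac_dvd _) ho_dvd_b)
      _ ≤ orderOf (2 : ZMod p) := Nat.minFac_le ho_pos
      _ ≤ p - 1 := Nat.le_of_dvd (by omega) ho_dvd_p
      _ < p := Nat.sub_lt hpp.out.pos Nat.one_pos

/-- **Higman's lemma on finite groups.** In a group in which every element has finite order (e.g. a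
finite group), four elements with `a₁⁻¹a₀a₁ = a₀²`, `a₂⁻¹a₁a₂ = a₁²`, `a₃⁻¹a₂a₃ = a₂²`, `a₀⁻¹a₃a₀ = a₃²`
are all trivial. [cite: Higman1951, §1] -/
theorem eq_one_of_cycle (htor : ∀ g : Q, IsOfFinOrder g) {a₀ a₁ a₂ a₃ : Q}
    (h₀ : a₁⁻¹ * a₀ * a₁ = a₀ ^ 2) (h₁ : a₂⁻¹ * a₁ * a₂ = a₁ ^ 2) (h₂ : a₃⁻¹ * a₂ * a₃ = a₂ ^ 2)
    (h₃ : a₀⁻¹ * a₃ * a₀ = a₃ ^ 2) : a₀ = 1 ∧ a₁ = 1 ∧ a₂ = 1 ∧ a₃ = 1 := by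
  have ha₀ : a₀ = 1 := by
    by_contra ha₀
    obtain ⟨ha₁, l₁⟩ := minFac_orderOf_lt h₀ (htor _) ha₀ (htor _)
    obtain ⟨ha₂, l₂⟩ := minFac_orderOf_lt h₁ (htor _) ha₁ (htor _)
    obtain ⟨ha₃, l₃⟩ := minFac_orderOf_lt h₂ (htor _) ha₂ (htor _)
    obtain ⟨-, l₀⟩ := minFac_orderOf_lt h₃ (htor _) ha₃ (htor _)
    omega
  -- once `a₀ = 1`, the cycle unwinds: `a₃ = a₃²`, `a₂ = a₂²`, `a₁ = a₁²`
  have ha₃ : a₃ = 1 := by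
    rw [ha₀, inv_one, one_mul, mul_one, sq] at h₃
    exact mul_eq_left.mp h₃.symm
  have ha₂ : a₂ = 1 := by
    rw [ha₃, inv_one, one_mul, mul_one, sq] at h₂
    exact mul_eq_left.mp h₂.symm
  have ha₁ : a₁ = 1 := by
    rw [ha₂, inv_one, one_mul, mul_one, sq] at h₁
    exact mul_eq_left.mp h₁.symm
  exact ⟨ha₀, ha₁, ha₂, ha₃⟩

end order

/-- **Higman's group has no non-trivial finite quotient**: every homomorphism to a finite group is
trivial (Higman 1951). [cite: Higman1951, §1] -/
theorem hom_finite_eq_one {Q : Type*} [Group Q] [Finite Q] (f : higmanGroup →* Q) : f = 1 := by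
  have hrel : ∀ {i j : Fin 4}, rel i j ∈ rels →
      (f (a j))⁻¹ * f (a i) * f (a j) = f (a i) ^ 2 := by
    intro i j h
    rw [← map_inv, ← map_mul, ← map_mul, conj_eq_sq h, map_pow]
  obtain ⟨h0, h1, h2, h3⟩ := eq_one_of_cycle (fun g => isOfFinOrder_of_finite g)
    (hrel (i := 0) (j := 1) (by simp [rels])) (hrel (i := 1) (j := 2) (by simp [rels]))
    (hrel (i := 2) (j := 3) (by simp [rels])) (hrel (i := 3) (j := 0) (by simp [rels]))
  have hgen : ∀ i : Fin 4, f (a i) = 1 := by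
    intro i; fin_cases i <;> assumption
  exact PresentedGroup.ext fun i => by simpa [a] using hgen i

/-- Hence every homomorphism from Higman's group to a finite group kills every element. [cite: Higman1951, §1] -/
theorem hom_finite_apply {Q : Type*} [Group Q] [Finite Q] (f : higmanGroup →* Q) (g : higmanGroup) :
    f g = 1 := by
  rw [hom_finite_eq_one f, MonoidHom.one_apply]

/-- **No proper subgroup of finite index.** A finite-index subgroup of Higman's group is everything:
its normal core has finite index, and the quotient map to the finite quotient is trivial.
[cite: Higman1951, §1] -/
theorem eq_top_of_finiteIndex (K : Subgroup higmanGroup) [K.FiniteIndex] : K = ⊤ := by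
  haveI : K.normalCore.FiniteIndex := Subgroup.finiteIndex_normalCore K
  haveI : K.normalCore.Normal := Subgroup.normalCore_normal K
  haveI : Finite (higmanGroup ⧸ K.normalCore) := Subgroup.finite_quotient_of_finiteIndex
  have hcore : K.normalCore = ⊤ := by
    rw [← QuotientGroup.ker_mk' K.normalCore, MonoidHom.ker_eq_top_iff]
    exact hom_finite_eq_one _
  exact top_le_iff.mp (hcore ▸ Subgroup.normalCore_le K)

/-- In particular the image of any finite-index subgroup of a group surjecting onto Higman's group is
everything: for a surjection `π : F →* higmanGroup` and `U ≤ F` of finite index, `U.map π = ⊤`.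
[cite: Higman1951, §1] -/
theorem map_eq_top_of_finiteIndex {F : Type*} [Group F] (π : F →* higmanGroup)
    (hπ : Function.Surjective π) (U : Subgroup F) [U.FiniteIndex] : U.map π = ⊤ := by
  haveI : (U.map π).FiniteIndex := by
    rw [Subgroup.finiteIndex_iff]
    intro h0
    have hd := Subgroup.index_map_dvd (H := U) hπ
    rw [h0, zero_dvd_iff] at hd
    exact (Subgroup.finiteIndex_iff.mp inferInstance) hd
  exact eq_top_of_finiteIndex _


/-! ## Non-triviality and infinitude -/

/-- Evaluating a Higman relator on a tuple. [folklore] -/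
theorem lift_rel {X : Type*} [Group X] (v : Fin 4 → X) (i j : Fin 4) :
    FreeGroup.lift v (rel i j) = (v j)⁻¹ * v i * v j * (v i)⁻¹ * (v i)⁻¹ := by
  simp [rel]

/-- A solution of `y⁻¹ x y = x²` kills the relator word `y⁻¹ x y x⁻¹ x⁻¹`. [folklore] -/
theorem rel_word_eq_one {X : Type*} [Group X] {x y : X} (h : y⁻¹ * x * y = x ^ 2) :
    y⁻¹ * x * y * x⁻¹ * x⁻¹ = 1 := by
  rw [h, sq, mul_assoc (x * x), ← mul_assoc (x * x), mul_assoc x x x⁻¹, mul_inv_cancel, mul_one,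
    mul_inv_cancel]


/-- The relator word `y⁻¹ x y x⁻¹ x⁻¹` is trivial iff `y⁻¹ x y = x²`. [folklore] -/
theorem rel_word_eq_one_iff {X : Type*} [Group X] {x y : X} :
    y⁻¹ * x * y * x⁻¹ * x⁻¹ = 1 ↔ y⁻¹ * x * y = x ^ 2 := by
  constructor
  · intro h
    calc y⁻¹ * x * y = (y⁻¹ * x * y * x⁻¹ * x⁻¹) * (x * x) := by group
      _ = x ^ 2 := by rw [h, one_mul, sq]
  · exact rel_word_eq_one

/-- **Higman's group is non-trivial**: the generator `a₀` is not the identity, because the four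
relations have a solution with `A ≠ 1` in the witness group `W` (Higman 1951, §2). [cite: Higman1951, §2] -/
theorem a_zero_ne_one : a 0 ≠ 1 := by
  obtain ⟨A, B, C, D, h0, h1, h2, h3, hA⟩ := exists_witness
  let v : Fin 4 → W := ![A, B, C, D]
  have hv0 : v 0 = A := rfl
  have hv1 : v 1 = B := rfl
  have hv2 : v 2 = C := rfl
  have hv3 : v 3 = D := rfl
  have hv : ∀ r ∈ rels, FreeGroup.lift v r = 1 := by
    intro r hr
    simp only [rels, Set.mem_insert_iff, Set.mem_singleton_iff] at hr
    rcases hr with rfl | rfl | rfl | rfl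
    · rw [lift_rel, hv0, hv1]; exact rel_word_eq_one h0
    · rw [lift_rel, hv1, hv2]; exact rel_word_eq_one h1
    · rw [lift_rel, hv2, hv3]; exact rel_word_eq_one h2
    · rw [lift_rel, hv3, hv0]; exact rel_word_eq_one h3
  let f : higmanGroup →* W := PresentedGroup.toGroup hv
  intro h
  apply hA
  have hf : f (a 0) = A := by
    simp [f, a, hv0]
  rw [← hf, h, map_one]

/-- Higman's group is non-trivial. [cite: Higman1951, §2] -/
instance nontrivial : Nontrivial higmanGroup := ⟨⟨a 0, 1, a_zero_ne_one⟩⟩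

/-- **Higman's group is infinite** (a non-trivial group all of whose finite-index subgroups are the
whole group). [cite: Higman1951, §1] -/
instance infinite : Infinite higmanGroup := by
  refine ⟨fun hfin => ?_⟩
  haveI : (⊥ : Subgroup higmanGroup).FiniteIndex := Subgroup.finiteIndex_of_finite_quotient
  have h := eq_top_of_finiteIndex (⊥ : Subgroup higmanGroup)
  have : (a 0 : higmanGroup) ∈ (⊥ : Subgroup higmanGroup) := by rw [h]; exact Subgroup.mem_top _
  exact a_zero_ne_one (Subgroup.mem_bot.mp this)

/-- The four relators as a `Fin 4`-indexed family. [cite: Higman1951, §1] -/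
def relFun : Fin 4 → FreeGroup (Fin 4) := ![rel 0 1, rel 1 2, rel 2 3, rel 3 0]

/-- `rels` is the range of `relFun`. [folklore] -/
theorem rels_eq_range_relFun : rels = Set.range relFun := by
  ext r
  simp only [rels, relFun, Set.mem_insert_iff, Set.mem_singleton_iff, Set.mem_range]
  constructor
  · rintro (rfl | rfl | rfl | rfl)
    · exact ⟨0, rfl⟩
    · exact ⟨1, rfl⟩
    · exact ⟨2, rfl⟩
    · exact ⟨3, rfl⟩
  · rintro ⟨i, rfl⟩
    fin_cases i <;> simp

/-- The relation subgroup `R = ⟪rels⟫` of Higman's presentation is a PROPER normal subgroup of `F₄`.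
[cite: Higman1951, §2] -/
theorem normalClosure_rels_ne_top : Subgroup.normalClosure rels ≠ (⊤ : Subgroup (FreeGroup (Fin 4))) := by
  intro htop
  apply a_zero_ne_one
  have hmem : FreeGroup.of (0 : Fin 4) ∈ Subgroup.normalClosure rels := htop ▸ Subgroup.mem_top _
  exact (QuotientGroup.eq_one_iff _).2 hmem

end HigmanGroup

end Literature.GroupTheory.CombinatorialGroupTheory
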